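import Summits.Ventures.Crystal3D.Theorems.StickyWulffConstantPolycrystalWulffBoundMinkowskiContentLocal
import Summits.Ventures.Crystal3D.Theorems.StickyWulffConstantPolycrystalWulffBoundMinkowskiTextureCells
import Summits.Ventures.Crystal3D.Theorems.StickyWulffConstantPolycrystalWulffBoundMinkowskiFreeEnergy

/-!
# `PolycrystalWulffBound`, rung `rung_basalLamellar` — step 2: the polyhedral anisotropic
# MINKOWSKI-CONTENT bound of a texture (line `PolyDensity`, crux `stmt-Ventures-19482`)

Route `StickyWulffConstant` of the venture `Summits/Ventures/Crystal3D`, second prover lane (poly-p2,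
gen 3).  **`volume_chimera_texture_le`**: for pairwise disjoint polyhedral grains `G_f` of finite
volume and origin-symmetric compact convex bodies `K_f ∋ 0`, for every `ε > 0` and all small `r > 0`,

  `|⋃_f (G_f + r K_f)| ≤ |⋃_f G_f| + r · (Fr + ε)`,   `Fr = Σ_f [per K_f (G f) − Σ_{g≠f} ι_{K_f}(G f, G g)]`

— the statement `stub_lamellarMinkowskiUpper` of the basal-lamellar skeleton.  Assembly of the texture
package (`exists_texture_package`), the content bound (`volume_chimera_le_of_package_local`), the
identification of the adjacency sum with the free energy (`adjSum_eq_freeEnergy_of_package`), the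
vanishing of facet areas inside two different planes, and the passage from grains to their cells
(grains lie in the closure of their cells; closures of finite unions of open convex sets have the same
volume, `Convex.addHaar_frontier`).
WHAT THIS IS NOT: the rung itself (one more composition with `lamellar_chimera_lower`).
-/

noncomputable section

namespace Summit.Ventures.Crystal3D.Theorems

open MeasureTheory Set Filter
open scoped RealInnerProductSpace ENNReal Pointwise Topology
open Summit.Ventures.Crystal3D.Cruxes.TextureLiminf.TexShadow

/-- A facet contained in two different unit planes has area zero (in the direction of the first
normal): its unit prism lies in a hyperplane, or is empty. -/
theorem facetArea_eq_zero_of_subset_two_planes {F : Set E3} {ν : E3} {β : ℝ} {π : E3 × ℝ}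
    (hν : ‖ν‖ = 1) (hπ : ‖π.1‖ = 1)
    (hF : F ⊆ {x : E3 | ⟪ν, x⟫ = β} ∩ {x : E3 | ⟪π.1, x⟫ = π.2})
    (hne : {x : E3 | ⟪ν, x⟫ = β} ≠ {x : E3 | ⟪π.1, x⟫ = π.2}) : facetArea F ν = 0 := by
  unfold facetArea
  have hνν : ⟪ν, ν⟫ = 1 := by rw [real_inner_self_eq_norm_sq, hν, one_pow]
  set m : E3 := π.1 - ⟪π.1, ν⟫ • ν with hm
  by_cases hm0 : m = 0
  · -- parallel planes: `π.1 = ⟪π.1, ν⟫ ν` with `⟪π.1,ν⟫ = ±1`, and the planes are disjoint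
    have hπν : π.1 = ⟪π.1, ν⟫ • ν := by rw [hm, sub_eq_zero] at hm0; exact hm0
    set c : ℝ := ⟪π.1, ν⟫ with hc
    have hc2 : c ^ 2 = 1 := by
      have : ‖π.1‖ ^ 2 = c ^ 2 := by rw [hπν, norm_smul, mul_pow, hν, Real.norm_eq_abs, sq_abs]; ring
      rw [hπ, one_pow] at this; exact this.symm
    have hempty : F = ∅ := by
      ext y
      simp only [mem_empty_iff_false, iff_false]
      intro hy
      obtain ⟨h1, h2⟩ := hF hy
      simp only [mem_setOf_eq] at h1 h2
      rw [hπν, real_inner_smul_left, h1] at h2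
      apply hne
      ext x
      simp only [mem_setOf_eq]
      rw [hπν, real_inner_smul_left]
      constructor
      · intro h; rw [h, h2]
      · intro h
        have : c * (c * ⟪ν, x⟫) = c * (c * β) := by rw [h, h2]
        have hcc : c * c = 1 := by nlinarith [hc2]
        calc ⟪ν, x⟫ = c * c * ⟪ν, x⟫ := by rw [hcc, one_mul]
          _ = c * c * β := by rw [mul_assoc, this, ← mul_assoc]
          _ = β := by rw [hcc, one_mul]
    rw [hempty]
    simp
  · -- transversal planes: the prism lies in the hyperplane `⟪m, x⟫ = π.2 − ⟪π.1,ν⟫ β`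
    have hsub : {x : E3 | ∃ y ∈ F, ∃ t ∈ Set.Icc (0 : ℝ) 1, x = y + t • ν} ⊆
        {x : E3 | ⟪m, x⟫ = π.2 - ⟪π.1, ν⟫ * β} := by
      rintro x ⟨y, hy, t, -, rfl⟩
      obtain ⟨h1, h2⟩ := hF hy
      simp only [mem_setOf_eq] at h1 h2 ⊢
      simp only [hm, inner_sub_left, inner_add_right, real_inner_smul_left, real_inner_smul_right, h1, h2,
        hνν]
      ring
    have h0 : volume {x : E3 | ∃ y ∈ F, ∃ t ∈ Set.Icc (0 : ℝ) 1, x = y + t • ν} = 0 :=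
      measure_mono_null hsub (volume_setOf_inner_eq_zero hm0 _)
    rw [h0, ENNReal.toReal_zero]

/-- The closure of a finite union of convex sets exceeds the union by a null set. -/
theorem volume_closure_diff_biUnion_eq_zero {ι : Type*} (s : Finset ι) (V : ι → Set E3)
    (hV : ∀ i ∈ s, Convex ℝ (V i)) :
    volume (closure (⋃ i ∈ s, V i) \ ⋃ i ∈ s, V i) = 0 := by
  classical
  induction s using Finset.induction_on with
  | empty => simp
  | @insert i s hi ih =>
    rw [Finset.set_biUnion_insert, closure_union]
    have hVi : Convex ℝ (V i) := hV i (Finset.mem_insert_self i s)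
    have hfr : volume (frontier (V i)) = 0 := hVi.addHaar_frontier volume
    have hA : volume (closure (V i) \ V i) = 0 := by
      refine measure_mono_null (fun x hx => ?_) hfr
      exact ⟨hx.1, fun h => hx.2 (interior_subset h)⟩
    have hB := ih fun j hj => hV j (Finset.mem_insert_of_mem hj)
    refine measure_mono_null (fun x hx => ?_) (measure_union_null hA hB)
    obtain ⟨hx1, hx2⟩ := hx
    rcases hx1 with h | h
    · exact Or.inl ⟨h, fun h' => hx2 (Or.inl h')⟩
    · exact Or.inr ⟨h, fun h' => hx2 (Or.inr h')⟩

/-- The closure of a finite union of convex sets has the same volume as the union. -/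
theorem volume_closure_biUnion_le_of_convex {ι : Type*} (s : Finset ι) (V : ι → Set E3)
    (hV : ∀ i ∈ s, Convex ℝ (V i)) :
    volume (closure (⋃ i ∈ s, V i)) ≤ volume (⋃ i ∈ s, V i) := by
  have h0 := volume_closure_diff_biUnion_eq_zero s V hV
  calc volume (closure (⋃ i ∈ s, V i))
      ≤ volume ((⋃ i ∈ s, V i) ∪ (closure (⋃ i ∈ s, V i) \ ⋃ i ∈ s, V i)) :=
        measure_mono fun x hx => by
          by_cases h : x ∈ ⋃ i ∈ s, V i
          · exact Or.inl h
          · exact Or.inr ⟨hx, h⟩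
    _ ≤ volume (⋃ i ∈ s, V i) + volume (closure (⋃ i ∈ s, V i) \ ⋃ i ∈ s, V i) := measure_union_le _ _
    _ = volume (⋃ i ∈ s, V i) := by rw [h0, add_zero]

/-- **The polyhedral anisotropic Minkowski-content bound of a texture.**  See the module docstring. -/
theorem volume_chimera_texture_le {n : ℕ} (G : Fin n → Set E3)
    (hPoly : ∀ f, ∃ (k : ℕ) (H : Fin k → Finset (E3 × ℝ)), G f = ⋃ i, polytope (H i))
    (hvol : ∀ f, volume (G f) < ⊤) (hdisjG : ∀ f g, f ≠ g → Disjoint (G f) (G g))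
    (K : Fin n → Set E3) (hKc : ∀ f, IsCompact (K f)) (hKv : ∀ f, Convex ℝ (K f))
    (hK0 : ∀ f, (0 : E3) ∈ K f) (hKs : ∀ f, -K f = K f) {ε : ℝ} (hε : 0 < ε) :
    ∃ r₀ : ℝ, 0 < r₀ ∧ ∀ r : ℝ, 0 < r → r < r₀ →
      (volume (⋃ f, ⋃ x ∈ G f, x +ᵥ (r • K f))).toReal ≤ (volume (⋃ f, G f)).toReal +
        r * ((∑ f, (per (K f) (G f) - ∑ g, (if f = g then 0 else
          (per (K f) (G f) + per (K f) (G g) - per (K f) (G f ∪ G g)) / 2))) + ε) := by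
  classical
  rcases Nat.eq_zero_or_pos n with hn | hn
  · subst hn
    refine ⟨1, one_pos, fun r hr _ => ?_⟩
    simp only [iUnion_of_empty, measure_empty, ENNReal.toReal_zero, Finset.univ_eq_empty,
      Finset.sum_empty, zero_add]
    positivity
  -- radii of the bodies
  have hKR0 : ∀ f, ∃ Rf : ℝ, K f ⊆ Metric.closedBall 0 Rf := fun f => (hKc f).isBounded.subset_closedBall 0
  choose Rf hRf using hKR0
  set R : ℝ := ∑ f, |Rf f| with hR
  have hR0 : 0 ≤ R := Finset.sum_nonneg fun f _ => abs_nonneg _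
  have hKR : ∀ f, K f ⊆ Metric.closedBall 0 R := by
    intro f y hy
    have h1 : ‖y‖ ≤ Rf f := mem_closedBall_zero_iff.1 (hRf f hy)
    rw [mem_closedBall_zero_iff]
    exact h1.trans ((le_abs_self _).trans
      (Finset.single_le_sum (fun g _ => abs_nonneg (Rf g)) (Finset.mem_univ f)))
  -- the texture package
  obtain ⟨𝓗, a, b, k, H, ν, S, gr, Adj, q₀, h1, hab, hmargin, hEbox, hne, hbd, hunit, hdist, hdisj, hanti,
    hplane, hinside, hae, hSsub, hS11, hgrS, hSdisj, hAdj, hAdj14, hcover⟩ :=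
    exists_texture_package hn G hPoly hvol hdisjG hR0
  obtain ⟨hbox_open, hbox_bdd⟩ := box_isOpen_isBounded a b
  -- the planes are null
  set N : Set E3 := ⋃ p ∈ 𝓗, {x : E3 | ⟪p.1, x⟫ = p.2} with hNdef
  have hN : volume N = 0 := volume_iUnion_planes_eq_zero 𝓗 fun p hp h0 => by
    have := h1 p hp; rw [h0, norm_zero] at this; exact zero_ne_one this
  have hoffN : ∀ x, x ∉ N → ∀ p ∈ 𝓗, ⟪p.1, x⟫ ≠ p.2 := fun x hx p hp hpx =>
    hx (mem_iUnion₂.2 ⟨p, hp, hpx⟩)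
  -- grains agree a.e. with their cells
  have hGS : ∀ f, G f =ᵐ[volume] ⋃ j ∈ S f, polytope (H j) := by
    intro f
    refine (ae_eq_set).2 ⟨measure_mono_null (fun x hx => ?_) hN, ?_⟩
    · by_contra hxN
      obtain ⟨j, hj, hxj⟩ := hS11 f x (hoffN x hxN) hx.1
      exact hx.2 (mem_iUnion₂.2 ⟨j, hj, hxj⟩)
    · rw [Set.sdiff_eq_empty.2 (fun x hx => ?_), measure_empty]
      obtain ⟨j, hj, hxj⟩ := mem_iUnion₂.1 hx
      exact hSsub f j hj hxj
  have hcl : ∀ f, closure (⋃ j ∈ S f, polytope (H j)) ⊆ interior (Rungs.box a b) := by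
    intro f
    rw [hbox_open.interior_eq]
    refine (closure_mono ?_).trans hEbox
    intro x hx
    obtain ⟨j, hj, hxj⟩ := mem_iUnion₂.1 hx
    exact mem_iUnion.2 ⟨f, hSsub f j hj hxj⟩
  -- non-adjacent facet areas vanish
  have hzero : ∀ f, ∀ a' ∈ S f, ∀ b', (∀ g, b' ∉ S g) → (a', b') ∉ Adj →
      facetArea (closure (polytope (H a')) ∩ closure (polytope (H b'))) (ν a' b') = 0 := by
    intro f a' ha' b' hb' hab'
    have hne' : a' ≠ b' := fun h => hb' f (h ▸ ha')
    obtain ⟨p, hp, p', hp', hpp', hsub⟩ := hAdj14 f a' ha' b' hb' hab'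
    obtain ⟨hνn, β, hνβ⟩ := hplane a' b' hne'
    by_cases hπ : {x : E3 | ⟪ν a' b', x⟫ = β} = {x : E3 | ⟪p.1, x⟫ = p.2}
    · -- use `p'`
      refine facetArea_eq_zero_of_subset_two_planes (π := p') hνn (h1 p' hp')
        (fun x hx => ⟨hνβ hx, (hsub hx).2⟩) ?_
      rw [hπ]; exact hpp'
    · exact facetArea_eq_zero_of_subset_two_planes (π := p) hνn (h1 p hp)
        (fun x hx => ⟨hνβ hx, (hsub hx).1⟩) hπ
  -- the adjacency sum is the free energy
  have hident := adjSum_eq_freeEnergy_of_package G H ν hbd hunit hdist hdisj hanti hplane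
    hbox_open.measurableSet hae (fun K' hK' hK'c h0' => perK_box_ne_top hK' hK'c h0' hab) S hSdisj hGS
    hcl gr hgrS Adj q₀ hAdj hzero K hKc hKv hK0 hKs
  -- the pairs of different planes
  set Pairs : Finset ((E3 × ℝ) × (E3 × ℝ)) := (𝓗 ×ˢ 𝓗).filter
    (fun pp => {x : E3 | ⟪pp.1.1, x⟫ = pp.1.2} ≠ {x : E3 | ⟪pp.2.1, x⟫ = pp.2.2}) with hPairs
  have hPairsP : ∀ pp ∈ Pairs, ‖pp.1.1‖ = 1 ∧ ‖pp.2.1‖ = 1 ∧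
      {x : E3 | ⟪pp.1.1, x⟫ = pp.1.2} ≠ {x : E3 | ⟪pp.2.1, x⟫ = pp.2.2} := by
    intro pp hpp
    obtain ⟨h12, hne'⟩ := Finset.mem_filter.1 hpp
    obtain ⟨hp1, hp2⟩ := Finset.mem_product.1 h12
    exact ⟨h1 _ hp1, h1 _ hp2, hne'⟩
  -- the content bound for the cells
  have hε2 : 0 < ε / 2 := by linarith
  obtain ⟨r₁, hr₁, hM⟩ := volume_chimera_le_of_package_local H hne hbd hunit S K hR0 hK0 hKR gr Adj q₀
    (fun t ht => (hAdj t ht).2.2.1) Pairs hPairsP N hN (by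
      intro r hr hr1 f a' ha' q hq w hw hxE hxN
      have hxbox : q + r • w ∈ Rungs.box a b := by
        refine hmargin q (mem_iUnion.2 ⟨f, hSsub f a' ha' hq⟩) (r • w) ?_
        rw [norm_smul, Real.norm_of_nonneg hr.le]
        calc r * ‖w‖ ≤ 1 * R := by gcongr; exact mem_closedBall_zero_iff.1 (hKR f hw)
          _ = R := one_mul R
      rcases hcover K R r hr hKR f a' ha' q hq w hw hxbox hxE (hoffN _ hxN) with h | ⟨p, hp, p', hp', hpl, h1', h2'⟩
      · exact Or.inl h
      · exact Or.inr ⟨(p, p'), Finset.mem_filter.2 ⟨Finset.mem_product.2 ⟨hp, hp'⟩, hpl⟩, h1', h2'⟩) hε2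
  -- from grains to cells: the chimera neighbourhood of the grains lies in the closure of that of the cells
  refine ⟨min r₁ 1, lt_min hr₁ one_pos, fun r hr hrr => ?_⟩
  have hrr₁ : r < r₁ := lt_of_lt_of_le hrr (min_le_left _ _)
  have hM' := hM r hr hrr₁
  set C : Set E3 := ⋃ f, ⋃ a' ∈ S f, ⋃ q ∈ polytope (H a'), q +ᵥ (r • K f) with hC
  set Cf : Fin n × Fin k → Set E3 := fun fa => polytope (H fa.2) + r • K fa.1 with hCf
  have hCeq : C = ⋃ fa ∈ Finset.univ.filter (fun fa : Fin n × Fin k => fa.2 ∈ S fa.1), Cf fa := by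
    ext y
    simp only [hC, hCf, mem_iUnion, Set.mem_vadd_set, vadd_eq_add, Finset.mem_filter, Finset.mem_univ,
      true_and, exists_prop, Set.mem_add]
    constructor
    · rintro ⟨f, a', ha', q, hq, v, hv, rfl⟩; exact ⟨(f, a'), ha', q, hq, v, hv, rfl⟩
    · rintro ⟨fa, ha', q, hq, v, hv, rfl⟩; exact ⟨fa.1, fa.2, ha', q, hq, v, hv, rfl⟩
  have hpolyconv : ∀ j, Convex ℝ (polytope (H j)) := fun j =>
    convex_iInter₂ fun q _ => convex_halfSpace_lt (innerSL ℝ q.1).isLinear q.2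
  have hCfconv : ∀ fa, Convex ℝ (Cf fa) := fun fa => (hpolyconv fa.2).add ((hKv fa.1).smul r)
  have hvolcl : volume (closure C) ≤ volume C := by
    rw [hCeq]; exact volume_closure_biUnion_le_of_convex _ Cf fun fa _ => hCfconv fa
  -- grains in the closure of their cells
  have hGcl : ∀ f, G f ⊆ closure (⋃ j ∈ S f, polytope (H j)) := by
    intro f x hx
    rw [mem_closure_iff_nhds]
    intro U hU
    obtain ⟨k', H', hGf⟩ := hPoly f
    have hGopen : IsOpen (G f) := by
      rw [hGf]
      exact isOpen_iUnion fun i => isOpen_biInter_finset fun q _ =>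
        isOpen_lt (continuous_const.inner continuous_id) continuous_const
    have hW : (interior U ∩ G f).Nonempty ∧ IsOpen (interior U ∩ G f) :=
      ⟨⟨x, mem_interior_iff_mem_nhds.2 hU, hx⟩, isOpen_interior.inter hGopen⟩
    have hpos : 0 < volume (interior U ∩ G f) := hW.2.measure_pos volume hW.1
    have hdiff : volume ((interior U ∩ G f) \ N) = volume (interior U ∩ G f) := measure_sdiff_null hN
    have hne'' : ((interior U ∩ G f) \ N).Nonempty := nonempty_of_measure_ne_zero (by rw [hdiff]; exact hpos.ne')
    obtain ⟨y, ⟨hyU, hyG⟩, hyN⟩ := hne''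
    obtain ⟨j, hj, hyj⟩ := hS11 f y (hoffN y hyN) hyG
    exact ⟨y, interior_subset hyU, mem_iUnion₂.2 ⟨j, hj, hyj⟩⟩
  have hsubC : (⋃ f, ⋃ x ∈ G f, x +ᵥ (r • K f)) ⊆ closure C := by
    intro y hy
    simp only [mem_iUnion, Set.mem_vadd_set, vadd_eq_add, exists_prop] at hy
    obtain ⟨f, x, hx, v, hv, rfl⟩ := hy
    have hxcl := hGcl f hx
    -- translate a limit of cell points
    rw [mem_closure_iff_seq_limit] at hxcl
    obtain ⟨u, hu, hux⟩ := hxcl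
    refine mem_closure_of_tendsto (hux.add tendsto_const_nhds) (Filter.Eventually.of_forall fun m => ?_)
    obtain ⟨j, hj, huj⟩ := mem_iUnion₂.1 (hu m)
    simp only [hC, mem_iUnion, Set.mem_vadd_set, vadd_eq_add, exists_prop]
    exact ⟨f, j, hj, u m, huj, v, hv, rfl⟩
  have hcells_sub : (⋃ f, ⋃ a' ∈ S f, polytope (H a')) ⊆ ⋃ f, G f :=
    iUnion_mono fun f x hx => by
      obtain ⟨j, hj, hxj⟩ := mem_iUnion₂.1 hx; exact hSsub f j hj hxj
  -- finiteness
  have hEfin : volume (⋃ f, G f) ≠ ⊤ :=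
    ((measure_iUnion_le G).trans_lt (by rw [tsum_fintype]; exact ENNReal.sum_lt_top.2 fun f _ => hvol f)).ne
  have hCfin : volume C ≠ ⊤ := by
    rw [hCeq]
    refine ((measure_biUnion_finset_le _ Cf).trans_lt (ENNReal.sum_lt_top.2 fun fa _ => ?_)).ne
    exact ((hbox_bdd.subset (hinside fa.2)).add ((hKc fa.1).smul r).isBounded).measure_lt_top
  -- assemble
  have hident' : (∑ t ∈ Adj, sSup ((fun y => ⟪y, -(q₀ t).1⟫) '' K (gr t.1)) *
      (volume {x : E3 | ∃ y ∈ closure (⋂ q' ∈ H t.2, {x : E3 | ⟪q'.1, x⟫ < q'.2}) ∩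
          {x | ⟪(q₀ t).1, x⟫ = (q₀ t).2}, ∃ s ∈ Set.Icc (0 : ℝ) 1, x = y + s • (q₀ t).1}).toReal) =
      ∑ f, (per (K f) (G f) - ∑ g, (if f = g then 0 else
        (per (K f) (G f) + per (K f) (G g) - per (K f) (G f ∪ G g)) / 2)) := hident
  have h1' : (volume (⋃ f, ⋃ x ∈ G f, x +ᵥ (r • K f))).toReal ≤ (volume C).toReal :=
    ENNReal.toReal_mono hCfin ((measure_mono hsubC).trans hvolcl)
  have h2' : (volume (⋃ f, ⋃ a' ∈ S f, ⋂ q' ∈ H a', {x : E3 | ⟪q'.1, x⟫ < q'.2})).toReal ≤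
      (volume (⋃ f, G f)).toReal := ENNReal.toReal_mono hEfin (measure_mono hcells_sub)
  have hM'' : (volume C).toReal ≤ (volume (⋃ f, ⋃ a' ∈ S f, ⋂ q' ∈ H a', {x : E3 | ⟪q'.1, x⟫ < q'.2})).toReal +
      r * ((∑ f, (per (K f) (G f) - ∑ g, (if f = g then 0 else
        (per (K f) (G f) + per (K f) (G g) - per (K f) (G f ∪ G g)) / 2))) + ε / 2) := by
    rw [← hident']; exact hM'
  have hr2 : r * (ε / 2) ≤ r * ε := by nlinarith
  linarith

end Summit.Ventures.Crystal3D.Theorems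

end
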